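import Mathlib
import HarnessLib

/-!
# The convex subdifferential, directional derivatives and the max formula (Borwein–Zhu 2005, §4.2)

Literature anchor for J. M. Borwein and Q. J. Zhu, *Techniques of Variational Analysis*
(CMS Books in Mathematics, Springer, 2005), Chapter 4 "Variational Techniques in Convex
Analysis", Section 4.2 "Subdifferential", pp. 117–125 (book index: subdifferential 117,
normal cone 117, directional derivative 117, sublinear / linearity space 118, subgradients and
directional derivatives 119, max formula 120, Gâteaux differentiable 121, subgradients of the
norm 123, recognizing convex functions 124):

* the convex **subdifferential** (4.2.1) `∂f(x) = {x* ∈ X* | f(y) - f(x) ≥ ⟨x*, y - x⟩ ∀ y}`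
  (`convexSubdiff`), its domain, the **normal cone** `N(C; x̄) = ∂ι_C(x̄)` (`convexNormalCone`)
  with its characterization (Exercise 4.2.7), Proposition 4.2.1 (subdifferential at optimality:
  `x̄` minimizes `f` iff `0 ∈ ∂f(x̄)`), Exercise 4.2.2 (`∂f(x)` is closed and convex);
* §4.2.2: the **directional derivative** `f'(x; d) = lim_{t → 0+} (f(x + td) - f(x))/t`
  (`convexDirDeriv`), **sublinear** / positively homogeneous / subadditive functions and the
  **linearity space** `lin p` (Propositions 4.2.2 and 4.2.3), Exercise 4.2.1 (monotonicity of
  the difference quotient), Proposition 4.2.4 (at a core point of `dom f` the directional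
  derivative exists, satisfies (4.2.2) and is sublinear), Proposition 4.2.5
  (`x* ∈ ∂f(x̄) ⟺ x* ≤ f'(x̄; ·)`);
* §4.2.3: the step of the printed proof of Theorem 4.2.7 bounding `|f'(x̄; h)| ≤ L‖h‖` by a
  local Lipschitz constant, **Theorem 4.2.7 (max formula)**
  `f'(x̄; d) = max {⟨x*, d⟩ | x* ∈ ∂f(x̄)}` and **Theorem 4.2.8 (nonemptiness of the
  subdifferential)** under the constraint qualification **Q2** (`x̄ ∈ cont f`),
  Corollary 4.2.9 (Gâteaux differentiability ⟺ a unique subgradient), the example following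
  Corollary 4.2.9 (`∂f(0) = ∅` for `f(x) = -√x` on `x ≥ 0`, = Exercise 4.2.3 (iii));
* Exercises 4.2.3 (i), (ii) (`∂|·|(0) = [-1, 1]`, `∂ι_{ℝ₊}(0) = (-∞, 0]`), Exercise 4.2.4
  (subgradients of the norm), Exercise 4.2.16 (i) (direction "`∂f` nonempty everywhere ⇒ `f`
  convex", in any normed space) and the monotonicity inequality
  `⟨x* - y*, x - y⟩ ≥ 0` of Exercise 4.2.21 for subgradients.

## Encoding and declared deviations

* `X` is a real normed space; the book's dual `X*` is `X →L[ℝ] ℝ`. An extended-valued convex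
  `f : X → ℝ ∪ {+∞}` is encoded, as in the other anchors of this chapter, by a real-valued
  `f : X → ℝ` together with its effective domain `D = dom f` and the hypothesis `ConvexOn ℝ D f`;
  accordingly `∂f(x)` is `convexSubdiff D f x = {x* | ∀ y ∈ D, x* (y - x) ≤ f y - f x}` (for
  `y ∉ dom f` the printed inequality is automatic). The book's convention `∂f(x) = ∅` for
  `x ∉ dom f` is not built into the definition; every statement about `∂f(x)` below carries
  `x ∈ D` where it matters.
* The indicator function `ι_C` is encoded by `D = C`, `f = 0`, so `N(C; x̄) = ∂ι_C(x̄)` is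
  `convexSubdiff C 0 x̄`; `convexNormalCone` is *defined* this way and Exercise 4.2.7 is the
  lemma `mem_convexNormalCone_iff`.
* The directional derivative is realised as the right derivative at `0` of `t ↦ f(x + t • d)`
  (`derivWithin _ (Set.Ioi 0) 0`, a real number, junk value `0` when the limit does not exist);
  Proposition 4.2.4 is the statement that at a core point this number *is* the limit (4.2.2) of
  the difference quotients (`tendsto_slope_convexDirDeriv`), via Mathlib's one-variable theory
  of one-sided derivatives of convex functions.
* The condition `x̄ ∈ core(dom f)` is spelled out as `∀ d, ∃ t > 0, x̄ + t • d ∈ D` (the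
  book's definition of the core, p. 114); it follows from `D ∈ 𝓝 x̄` (`core_of_mem_nhds`).
* Theorems 4.2.7 / 4.2.8 and Corollary 4.2.9 are proved under **Q2** (`x̄ ∈ cont f`:
  `D ∈ 𝓝 x̄` and `f` continuous at `x̄`); the printed reduction of **Q1** (`x̄ ∈ core(dom f)`,
  `f` lsc, `X` Banach) to Q2 goes through Theorems 4.1.3 and 4.1.8 and is not repeated here.
  The Zorn's-lemma construction of the printed proof is replaced by Mathlib's dominated
  extension theorem `exists_extension_of_le_sublinear` (the Hahn–Banach form of the same
  argument), applied to the linear functional `t d ↦ t f'(x̄; d)` on `span {d}`.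
* Not formalised: Lemma 4.2.6 and Exercise 4.2.13 (ingredients of the Zorn argument only),
  Example 4.2.10 and Exercises 4.2.5, 4.2.6, 4.2.8, 4.2.10 (`∂f = ∂_F f`, which would import the
  Fréchet subdifferential anchor), 4.2.14, 4.2.17–4.2.22.
-/

open Set Filter Topology

namespace Literature.Analysis.Convex.ConvexSubdifferentialMaxFormula

variable {X : Type*} [NormedAddCommGroup X] [NormedSpace ℝ X]

/-! ## §4.2.1 The subdifferential (4.2.1), the normal cone, Proposition 4.2.1 -/

section Subdifferential

variable {D C : Set X} {f : X → ℝ} {x y : X} {xs ys : X →L[ℝ] ℝ}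

/-- The convex **subdifferential** (4.2.1) of `f` (with effective domain `D`) at `x`:
`∂f(x) = {x* ∈ X* | f(y) - f(x) ≥ ⟨x*, y - x⟩ for all y ∈ dom f}`; its elements are the
subgradients of `f` at `x`.
[cite: BorweinZhu2005, §4.2.1, (4.2.1), p. 117] -/
def convexSubdiff (D : Set X) (f : X → ℝ) (x : X) : Set (X →L[ℝ] ℝ) :=
  {xs | ∀ y ∈ D, xs (y - x) ≤ f y - f x}

/-- [cite: BorweinZhu2005, §4.2.1, (4.2.1), p. 117] -/
theorem mem_convexSubdiff_iff :
    xs ∈ convexSubdiff D f x ↔ ∀ y ∈ D, xs (y - x) ≤ f y - f x :=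
  Iff.rfl

/-- The domain of the subdifferential `dom ∂f = {x ∈ dom f | ∂f(x) ≠ ∅}`.
[cite: BorweinZhu2005, §4.2.1, p. 117] -/
def convexSubdiffDom (D : Set X) (f : X → ℝ) : Set X :=
  {x | x ∈ D ∧ (convexSubdiff D f x).Nonempty}

/-- [cite: BorweinZhu2005, §4.2.1, p. 117] -/
theorem convexSubdiffDom_subset : convexSubdiffDom D f ⊆ D := fun _ hx => hx.1

/-- The **normal cone** of a convex set `C` at `x̄`, `N(C; x̄) = ∂ι_C(x̄)` (the indicator
function `ι_C` being encoded by the domain `C` and the zero function).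
[cite: BorweinZhu2005, §4.2.1, p. 117] -/
def convexNormalCone (C : Set X) (x : X) : Set (X →L[ℝ] ℝ) :=
  convexSubdiff C (fun _ => 0) x

/-- **Exercise 4.2.7** (normal cone's characterization): `x* ∈ N(C; x)` iff
`⟨x*, y - x⟩ ≤ 0` for all `y ∈ C`.
[cite: BorweinZhu2005, §4.2.1, p. 117; §4.2.4, Exercise 4.2.7, p. 123] -/
theorem mem_convexNormalCone_iff :
    xs ∈ convexNormalCone C x ↔ ∀ y ∈ C, xs (y - x) ≤ 0 := by
  simp [convexNormalCone, convexSubdiff]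

/-- **Proposition 4.2.1** (Subdifferential at Optimality): `x̄` is a (global) minimizer of `f`
on `dom f` if and only if `0 ∈ ∂f(x̄)` (proof = Exercise 4.2.9).
[cite: BorweinZhu2005, §4.2.1, Prop 4.2.1, pp. 117–118; §4.2.4, Exercise 4.2.9, p. 123] -/
theorem isMinOn_iff_zero_mem_convexSubdiff :
    IsMinOn f D x ↔ (0 : X →L[ℝ] ℝ) ∈ convexSubdiff D f x := by
  simp [convexSubdiff, isMinOn_iff, sub_nonneg]

/-- **Exercise 4.2.2**: the subdifferential at a point is a convex set.
[cite: BorweinZhu2005, §4.2.4, Exercise 4.2.2, p. 122] -/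
theorem convex_convexSubdiff (D : Set X) (f : X → ℝ) (x : X) :
    Convex ℝ (convexSubdiff D f x) := by
  intro xs hxs ys hys a b ha hb hab y hy
  have h1 := hxs y hy
  have h2 := hys y hy
  simp only [mem_setOf_eq, convexSubdiff, add_apply, smul_apply, smul_eq_mul] at *
  have h1' := mul_le_mul_of_nonneg_left h1 ha
  have h2' := mul_le_mul_of_nonneg_left h2 hb
  calc a * xs (y - x) + b * ys (y - x) ≤ a * (f y - f x) + b * (f y - f x) := add_le_add h1' h2'
    _ = f y - f x := by rw [← add_mul, hab, one_mul]

/-- **Exercise 4.2.2**: the subdifferential at a point is a closed set (in the dual norm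
topology).
[cite: BorweinZhu2005, §4.2.4, Exercise 4.2.2, p. 122] -/
theorem isClosed_convexSubdiff (D : Set X) (f : X → ℝ) (x : X) :
    IsClosed (convexSubdiff D f x) := by
  have : convexSubdiff D f x = ⋂ y ∈ D, {xs : X →L[ℝ] ℝ | xs (y - x) ≤ f y - f x} := by
    ext xs; simp [convexSubdiff]
  rw [this]
  exact isClosed_biInter fun y _ =>
    isClosed_le (continuous_eval_const (y - x)) continuous_const

/-- Subgradients are monotone: `⟨x* - y*, x - y⟩ ≥ 0` for `x* ∈ ∂f(x)`, `y* ∈ ∂f(y)`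
(cf. Exercise 4.2.21, monotonicity of gradients).
[cite: BorweinZhu2005, §4.2.4, Exercise 4.2.21, p. 125] -/
theorem sub_apply_sub_nonneg_of_mem_convexSubdiff (hx : x ∈ D) (hy : y ∈ D)
    (hxs : xs ∈ convexSubdiff D f x) (hys : ys ∈ convexSubdiff D f y) :
    0 ≤ (xs - ys) (x - y) := by
  have h1 := hxs y hy
  have h2 := hys x hx
  have e1 : xs (y - x) = -xs (x - y) := by rw [← map_neg, neg_sub]
  rw [sub_apply]
  linarith

/-- **Exercise 4.2.16 (i)**, direction "⇒", valid in any normed space: if `∂f(x) ≠ ∅` for every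
`x` in the convex set `dom f`, then `f` is convex.
[cite: BorweinZhu2005, §4.2.4, Exercise 4.2.16 (i), p. 124] -/
theorem convexOn_of_convexSubdiff_nonempty (hD : Convex ℝ D)
    (h : ∀ x ∈ D, (convexSubdiff D f x).Nonempty) : ConvexOn ℝ D f := by
  refine ⟨hD, fun u hu v hv a b ha hb hab => ?_⟩
  set z := a • u + b • v with hz
  obtain ⟨xs, hxs⟩ := h z (hD hu hv ha hb hab)
  have h1 := hxs u hu
  have h2 := hxs v hv
  have e : a * xs (u - z) + b * xs (v - z) = 0 := by
    have : a • (u - z) + b • (v - z) = 0 := by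
      rw [hz, smul_sub, smul_sub, smul_add, smul_add, smul_smul, smul_smul, smul_smul, smul_smul]
      have hb' : b = 1 - a := by linarith
      rw [hb']
      module
    have := congrArg xs this
    rwa [map_add, map_smul, map_smul, map_zero, smul_eq_mul, smul_eq_mul] at this
  have h1' := mul_le_mul_of_nonneg_left h1 ha
  have h2' := mul_le_mul_of_nonneg_left h2 hb
  have hfz : f z = a * f z + b * f z := by rw [← add_mul, hab, one_mul]
  simp only [smul_eq_mul]
  linarith

end Subdifferential

/-! ## §4.2.2 Sublinear functions (Propositions 4.2.2 and 4.2.3) -/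

section Sublinear

variable {p : X → ℝ} {x y : X}

/-- `p` is **sublinear**: `p(λx + μy) ≤ λ p(x) + μ p(y)` for all `x, y` and `λ, μ ≥ 0`.
[cite: BorweinZhu2005, §4.2.2, p. 118] -/
def IsSublinear (p : X → ℝ) : Prop :=
  ∀ x y : X, ∀ a b : ℝ, 0 ≤ a → 0 ≤ b → p (a • x + b • y) ≤ a * p x + b * p y

/-- `p` is **positively homogeneous**: `p(λx) = λ p(x)` for `λ ≥ 0` (in particular `p 0 = 0`).
[cite: BorweinZhu2005, §4.2.2, p. 118] -/
def IsPosHomogeneous (p : X → ℝ) : Prop :=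
  ∀ x : X, ∀ a : ℝ, 0 ≤ a → p (a • x) = a * p x

/-- `p` is **subadditive**: `p(x + y) ≤ p(x) + p(y)`.
[cite: BorweinZhu2005, §4.2.2, p. 118] -/
def IsSubadditive (p : X → ℝ) : Prop :=
  ∀ x y : X, p (x + y) ≤ p x + p y

/-- [cite: BorweinZhu2005, §4.2.2, p. 118] -/
theorem IsSublinear.map_zero (hp : IsSublinear p) : p 0 = 0 := by
  have h1 := hp 0 0 0 0 le_rfl le_rfl
  have h2 := hp 0 0 1 1 zero_le_one zero_le_one
  simp only [smul_zero, add_zero, zero_mul, one_mul] at h1 h2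
  linarith

/-- [cite: BorweinZhu2005, §4.2.2, p. 118] -/
theorem IsSublinear.isPosHomogeneous (hp : IsSublinear p) : IsPosHomogeneous p := by
  intro x a ha
  have h1 : p (a • x) ≤ a * p x := by
    have := hp x x a 0 ha le_rfl
    simpa using this
  rcases ha.eq_or_lt with rfl | ha'
  · simp [hp.map_zero]
  · refine le_antisymm h1 ?_
    have h2 : p x ≤ a⁻¹ * p (a • x) := by
      have := hp (a • x) x a⁻¹ 0 (inv_nonneg.2 ha) le_rfl
      simpa [smul_smul, inv_mul_cancel₀ ha'.ne'] using this
    have := mul_le_mul_of_nonneg_left h2 ha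
    rwa [← mul_assoc, mul_inv_cancel₀ ha'.ne', one_mul] at this

/-- [cite: BorweinZhu2005, §4.2.2, p. 118] -/
theorem IsSublinear.isSubadditive (hp : IsSublinear p) : IsSubadditive p := by
  intro x y
  simpa using hp x y 1 1 zero_le_one zero_le_one

/-- **Proposition 4.2.2** (Sublinearity): `p` is sublinear if and only if it is positively
homogeneous and subadditive (proof = Exercise 4.2.11).
[cite: BorweinZhu2005, §4.2.2, Prop 4.2.2, p. 118; §4.2.4, Exercise 4.2.11, p. 123] -/
theorem isSublinear_iff : IsSublinear p ↔ IsPosHomogeneous p ∧ IsSubadditive p := by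
  refine ⟨fun hp => ⟨hp.isPosHomogeneous, hp.isSubadditive⟩, fun ⟨h1, h2⟩ => ?_⟩
  intro x y a b ha hb
  calc p (a • x + b • y) ≤ p (a • x) + p (b • y) := h2 _ _
    _ = a * p x + b * p y := by rw [h1 x a ha, h1 y b hb]

/-- A sublinear function is convex.
[cite: BorweinZhu2005, §4.2.2, p. 118] -/
theorem IsSublinear.convexOn (hp : IsSublinear p) : ConvexOn ℝ univ p :=
  ⟨convex_univ, fun x _ y _ a b ha hb _ => by simpa using hp x y a b ha hb⟩

/-- "It is immediate that if `p` is sublinear then `-p(x) ≤ p(-x)` for all `x`."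
[cite: BorweinZhu2005, §4.2.2, p. 118] -/
theorem IsSublinear.neg_le (hp : IsSublinear p) (x : X) : -p x ≤ p (-x) := by
  have := hp.isSubadditive x (-x)
  rw [add_neg_cancel, hp.map_zero] at this
  linarith

/-- The **linearity space** of a sublinear function, `lin p = {x | -p(x) = p(-x)}`.
[cite: BorweinZhu2005, §4.2.2, p. 118] -/
def linSpace (p : X → ℝ) : Set X :=
  {x | -p x = p (-x)}

omit [NormedSpace ℝ X] in
/-- [cite: BorweinZhu2005, §4.2.2, p. 118] -/
theorem mem_linSpace_iff : x ∈ linSpace p ↔ -p x = p (-x) := Iff.rfl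

/-- [cite: BorweinZhu2005, §4.2.2, Prop 4.2.3, pp. 118–119] -/
theorem IsSublinear.smul_mem_linSpace (hp : IsSublinear p) (hx : x ∈ linSpace p) (a : ℝ) :
    a • x ∈ linSpace p := by
  have hh := hp.isPosHomogeneous
  rw [mem_linSpace_iff] at hx ⊢
  rcases le_or_gt 0 a with ha | ha
  · rw [show -(a • x) = a • (-x) by rw [smul_neg], hh x a ha, hh (-x) a ha, ← hx, mul_neg]
  · have ha' : 0 ≤ -a := by linarith
    rw [show a • x = (-a) • (-x) by rw [smul_neg, neg_smul, neg_neg],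
      show -((-a) • -x) = (-a) • x by rw [smul_neg, neg_neg], hh (-x) (-a) ha', hh x (-a) ha',
      ← hx]
    ring

/-- [cite: BorweinZhu2005, §4.2.2, Prop 4.2.3, pp. 118–119] -/
theorem IsSublinear.add_mem_linSpace (hp : IsSublinear p) (hx : x ∈ linSpace p)
    (hy : y ∈ linSpace p) : x + y ∈ linSpace p := by
  have hs := hp.isSubadditive
  rw [mem_linSpace_iff] at hx hy ⊢
  have h1 := hs x y
  have h2 := hs (-x) (-y)
  have h3 := hp.neg_le (x + y)
  rw [← neg_add] at h2
  linarith

/-- **Proposition 4.2.3** (Linearity Space): the linearity space of a sublinear function is a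
linear subspace.
[cite: BorweinZhu2005, §4.2.2, Prop 4.2.3, pp. 118–119] -/
def IsSublinear.linSubmodule (hp : IsSublinear p) : Submodule ℝ X where
  carrier := linSpace p
  zero_mem' := by simp [linSpace, hp.map_zero]
  add_mem' hx hy := hp.add_mem_linSpace hx hy
  smul_mem' a _ hx := hp.smul_mem_linSpace hx a

/-- [cite: BorweinZhu2005, §4.2.2, Prop 4.2.3, pp. 118–119] -/
theorem IsSublinear.coe_linSubmodule (hp : IsSublinear p) :
    (hp.linSubmodule : Set X) = linSpace p :=
  rfl

/-- **Proposition 4.2.3**: `p` is additive on `lin p`.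
[cite: BorweinZhu2005, §4.2.2, Prop 4.2.3, pp. 118–119] -/
theorem IsSublinear.map_add_of_mem_linSpace (hp : IsSublinear p) (hx : x ∈ linSpace p)
    (hy : y ∈ linSpace p) : p (x + y) = p x + p y := by
  have hs := hp.isSubadditive
  have hxy := hp.add_mem_linSpace hx hy
  rw [mem_linSpace_iff] at hx hy hxy
  have h1 := hs x y
  have h2 := hs (-x) (-y)
  rw [← neg_add] at h2
  linarith

/-- **Proposition 4.2.3**: `p` is homogeneous on `lin p`.
[cite: BorweinZhu2005, §4.2.2, Prop 4.2.3, pp. 118–119] -/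
theorem IsSublinear.map_smul_of_mem_linSpace (hp : IsSublinear p) (hx : x ∈ linSpace p)
    (a : ℝ) : p (a • x) = a * p x := by
  have hh := hp.isPosHomogeneous
  rcases le_or_gt 0 a with ha | ha
  · exact hh x a ha
  · rw [mem_linSpace_iff] at hx
    have ha' : 0 ≤ -a := by linarith
    rw [show a • x = (-a) • (-x) by rw [smul_neg, neg_smul, neg_neg], hh (-x) (-a) ha', ← hx]
    ring

/-- **Proposition 4.2.3**: `lin p` is the largest subspace on which `p` is linear — any
subspace on which `p` is homogeneous is contained in `lin p`.
[cite: BorweinZhu2005, §4.2.2, Prop 4.2.3, pp. 118–119] -/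
theorem subset_linSpace_of_map_smul (W : Submodule ℝ X)
    (hW : ∀ x ∈ W, ∀ a : ℝ, p (a • x) = a * p x) : (W : Set X) ⊆ linSpace p := by
  intro x hx
  rw [mem_linSpace_iff]
  have := hW x hx (-1)
  rw [neg_one_smul] at this
  linarith

end Sublinear

/-! ## §4.2.2 Directional derivatives (Exercise 4.2.1, Propositions 4.2.4 and 4.2.5) -/

section DirectionalDerivative

variable {D : Set X} {f : X → ℝ} {x : X}

/-- The **directional derivative** `f'(x; d) = lim_{t → 0+} (f(x + td) - f(x))/t`, realised as
the right derivative at `0` of `t ↦ f(x + t • d)`.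
[cite: BorweinZhu2005, §4.2.2, pp. 117–118] -/
noncomputable def convexDirDeriv (f : X → ℝ) (x d : X) : ℝ :=
  derivWithin (fun t : ℝ => f (x + t • d)) (Ioi 0) 0

/-- `x ∈ core D` follows from `D ∈ 𝓝 x` (core ⊇ interior).
[cite: BorweinZhu2005, §4.1.3, p. 114] -/
theorem core_of_mem_nhds (hD : D ∈ 𝓝 x) (d : X) : ∃ t : ℝ, 0 < t ∧ x + t • d ∈ D := by
  have hc : Tendsto (fun t : ℝ => x + t • d) (𝓝 0) (𝓝 x) := by
    have : Continuous fun t : ℝ => x + t • d := by fun_prop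
    simpa using this.tendsto 0
  obtain ⟨t, ht, htD⟩ := (hc.eventually_mem hD).exists_gt
  exact ⟨t, ht, htD⟩

/-- The restriction of a convex function to a line is convex. [folklore] -/
private lemma convexOn_line (hf : ConvexOn ℝ D f) (x d : X) :
    ConvexOn ℝ {t : ℝ | x + t • d ∈ D} (fun t : ℝ => f (x + t • d)) := by
  have key : ∀ (s t a b : ℝ), a + b = 1 →
      x + (a • s + b • t) • d = a • (x + s • d) + b • (x + t • d) := by
    intro s t a b hab
    have hb : b = 1 - a := by linarith
    subst hb
    simp only [smul_eq_mul]
    module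
  refine ⟨fun s hs t ht a b ha hb hab => ?_, fun s hs t ht a b ha hb hab => ?_⟩
  · show x + (a • s + b • t) • d ∈ D
    rw [key s t a b hab]
    exact hf.1 hs ht ha hb hab
  · show f (x + (a • s + b • t) • d) ≤ a • f (x + s • d) + b • f (x + t • d)
    rw [key s t a b hab]
    exact hf.2 hs ht ha hb hab

/-- At a core point the line through `x` in direction `d` meets `D` in a neighbourhood of
`t = 0`. [folklore] -/
private lemma zero_mem_interior_line (hD : Convex ℝ D)
    (hcore : ∀ d : X, ∃ t : ℝ, 0 < t ∧ x + t • d ∈ D) (d : X) :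
    (0 : ℝ) ∈ interior {t : ℝ | x + t • d ∈ D} := by
  obtain ⟨t₁, ht₁, h₁⟩ := hcore d
  obtain ⟨t₂, ht₂, h₂⟩ := hcore (-d)
  have h₂' : x + (-t₂) • d ∈ D := by simpa [smul_neg, neg_smul] using h₂
  have hconv : Convex ℝ {t : ℝ | x + t • d ∈ D} := by
    intro s hs t ht a b ha hb hab
    have hb' : b = 1 - a := by linarith
    have e : x + (a • s + b • t) • d = a • (x + s • d) + b • (x + t • d) := by
      subst hb'; simp only [smul_eq_mul]; module
    show x + (a • s + b • t) • d ∈ D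
    rw [e]; exact hD hs ht ha hb hab
  have hsub : Icc (-t₂) t₁ ⊆ {t : ℝ | x + t • d ∈ D} := by
    rw [← segment_eq_Icc (by linarith)]
    exact hconv.segment_subset h₂' h₁
  exact mem_interior.2 ⟨Ioo (-t₂) t₁, Ioo_subset_Icc_self.trans hsub, isOpen_Ioo,
    ⟨by linarith, ht₁⟩⟩

/-- **Exercise 4.2.1**: for a convex `f` and `x̄ ∈ dom f`, the difference quotient
`t ↦ (f(x̄ + td) - f(x̄))/t` is nondecreasing (on the nonzero `t` with `x̄ + td ∈ dom f`).
[cite: BorweinZhu2005, §4.2.4, Exercise 4.2.1, p. 122; §4.2.2, proof of Prop 4.2.4, p. 119] -/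
theorem monotoneOn_slope_of_convexOn (hf : ConvexOn ℝ D f) (hx : x ∈ D) (d : X) :
    MonotoneOn (fun t : ℝ => (f (x + t • d) - f x) / t) ({t : ℝ | x + t • d ∈ D} \ {0}) := by
  have h0 : (0 : ℝ) ∈ {t : ℝ | x + t • d ∈ D} := by simpa using hx
  have := (convexOn_line hf x d).slope_mono h0
  refine this.congr fun t _ => ?_
  simp [slope_def_field]

/-- **Proposition 4.2.4** (existence of the directional derivative at a core point): the
right derivative of `t ↦ f(x̄ + td)` at `0` exists and equals `f'(x̄; d)`.
[cite: BorweinZhu2005, §4.2.2, Prop 4.2.4, p. 119] -/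
theorem hasDerivWithinAt_convexDirDeriv (hf : ConvexOn ℝ D f)
    (hcore : ∀ d : X, ∃ t : ℝ, 0 < t ∧ x + t • d ∈ D) (d : X) :
    HasDerivWithinAt (fun t : ℝ => f (x + t • d)) (convexDirDeriv f x d) (Ioi 0) 0 :=
  (convexOn_line hf x d).hasDerivWithinAt_rightDeriv_of_mem_interior
    (zero_mem_interior_line hf.1 hcore d)

/-- **Proposition 4.2.4** / (4.2.2): at a core point,
`f'(x̄; d) = lim_{t ↓ 0} (f(x̄ + td) - f(x̄))/t`.
[cite: BorweinZhu2005, §4.2.2, Prop 4.2.4, (4.2.2), p. 119] -/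
theorem tendsto_slope_convexDirDeriv (hf : ConvexOn ℝ D f)
    (hcore : ∀ d : X, ∃ t : ℝ, 0 < t ∧ x + t • d ∈ D) (d : X) :
    Tendsto (fun t : ℝ => (f (x + t • d) - f x) / t) (𝓝[>] 0) (𝓝 (convexDirDeriv f x d)) := by
  have h := hasDerivWithinAt_convexDirDeriv hf hcore d
  rw [hasDerivWithinAt_iff_tendsto_slope] at h
  simp only [mem_Ioi, lt_self_iff_false, not_false_eq_true, sdiff_singleton_eq_self] at h
  refine h.congr' (Eventually.of_forall fun t => ?_)
  simp [slope_def_field]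

/-- (4.2.2), upper half: `f'(x̄; d) ≤ (f(x̄ + td) - f(x̄))/t` for every `t > 0` with
`x̄ + td ∈ dom f` (the directional derivative is the infimum of the difference quotients).
[cite: BorweinZhu2005, §4.2.2, Prop 4.2.4, (4.2.2), p. 119] -/
theorem convexDirDeriv_le_slope (hf : ConvexOn ℝ D f)
    (hcore : ∀ d : X, ∃ t : ℝ, 0 < t ∧ x + t • d ∈ D) (d : X) {t : ℝ} (ht : 0 < t)
    (htD : x + t • d ∈ D) : convexDirDeriv f x d ≤ (f (x + t • d) - f x) / t := by
  have hint := zero_mem_interior_line hf.1 hcore d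
  have hconv := convexOn_line hf x d
  have e : convexDirDeriv f x d =
      sInf (slope (fun t : ℝ => f (x + t • d)) 0 '' {s | s ∈ {t : ℝ | x + t • d ∈ D} ∧ 0 < s}) :=
    hconv.rightDeriv_eq_sInf_slope_of_mem_interior hint
  rw [e]
  refine (csInf_le (bddBelow_slope_lt_of_mem_interior hconv hint) ⟨t, ⟨htD, ht⟩, rfl⟩).trans ?_
  simp [slope_def_field]

/-- (4.2.2), lower half: `(f(x̄ - sd) - f(x̄))/(-s) ≤ f'(x̄; d)` for every `s > 0` with
`x̄ - sd ∈ dom f`; in particular `f'(x̄; d) > -∞`.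
[cite: BorweinZhu2005, §4.2.2, Prop 4.2.4, (4.2.2), p. 119] -/
theorem slope_le_convexDirDeriv (hf : ConvexOn ℝ D f) (hx : x ∈ D)
    (hcore : ∀ d : X, ∃ t : ℝ, 0 < t ∧ x + t • d ∈ D) (d : X) {s : ℝ} (hs : 0 < s)
    (hsD : x + (-s) • d ∈ D) : (f (x + (-s) • d) - f x) / (-s) ≤ convexDirDeriv f x d := by
  have hmono := monotoneOn_slope_of_convexOn hf hx d
  have hlim := tendsto_slope_convexDirDeriv hf hcore d
  have hint := zero_mem_interior_line hf.1 hcore d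
  have hev : ∀ᶠ t in 𝓝[>] (0 : ℝ), x + t • d ∈ D :=
    mem_nhdsWithin_of_mem_nhds (mem_interior_iff_mem_nhds.1 hint)
  refine ge_of_tendsto hlim ?_
  filter_upwards [hev, self_mem_nhdsWithin] with t htD (ht : 0 < t)
  exact hmono ⟨hsD, by simp [hs.ne']⟩ ⟨htD, by simp [ht.ne']⟩ (by linarith)

/-- `f'(x̄; 0) = 0`.
[cite: BorweinZhu2005, §4.2.2, Prop 4.2.4, p. 119] -/
theorem convexDirDeriv_zero (f : X → ℝ) (x : X) : convexDirDeriv f x 0 = 0 := by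
  simp [convexDirDeriv]

/-- **Proposition 4.2.4** (positive homogeneity of the directional derivative):
`f'(x̄; λd) = λ f'(x̄; d)` for `λ ≥ 0`.
[cite: BorweinZhu2005, §4.2.2, Prop 4.2.4, p. 119] -/
theorem convexDirDeriv_smul (hf : ConvexOn ℝ D f)
    (hcore : ∀ d : X, ∃ t : ℝ, 0 < t ∧ x + t • d ∈ D) {a : ℝ} (ha : 0 ≤ a) (d : X) :
    convexDirDeriv f x (a • d) = a * convexDirDeriv f x d := by
  rcases ha.eq_or_lt with rfl | ha'
  · simp [convexDirDeriv_zero]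
  have h1 := tendsto_slope_convexDirDeriv hf hcore (a • d)
  have hmap : Tendsto (fun t : ℝ => a * t) (𝓝[>] 0) (𝓝[>] 0) := by
    apply tendsto_nhdsWithin_of_tendsto_nhds_of_eventually_within
    · have : Continuous fun t : ℝ => a * t := by fun_prop
      simpa using (this.tendsto 0).mono_left nhdsWithin_le_nhds
    · filter_upwards [self_mem_nhdsWithin] with t (ht : 0 < t)
      exact mul_pos ha' ht
  have h2 := ((tendsto_slope_convexDirDeriv hf hcore d).comp hmap).const_mul a
  have h3 : Tendsto (fun t : ℝ => (f (x + t • (a • d)) - f x) / t) (𝓝[>] 0)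
      (𝓝 (a * convexDirDeriv f x d)) := by
    refine h2.congr' ?_
    filter_upwards [self_mem_nhdsWithin] with t (ht : 0 < t)
    simp only [Function.comp_def]
    rw [smul_smul, mul_comm t a]
    field_simp
  exact tendsto_nhds_unique h1 h3

/-- **Proposition 4.2.4** (subadditivity of the directional derivative):
`f'(x̄; d + e) ≤ f'(x̄; d) + f'(x̄; e)`, from `g(d + e; t) ≤ g(d; 2t) + g(e; 2t)`.
[cite: BorweinZhu2005, §4.2.2, Prop 4.2.4, p. 119] -/
theorem convexDirDeriv_add_le (hf : ConvexOn ℝ D f)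
    (hcore : ∀ d : X, ∃ t : ℝ, 0 < t ∧ x + t • d ∈ D) (d e : X) :
    convexDirDeriv f x (d + e) ≤ convexDirDeriv f x d + convexDirDeriv f x e := by
  have hmap : Tendsto (fun t : ℝ => 2 * t) (𝓝[>] 0) (𝓝[>] 0) := by
    apply tendsto_nhdsWithin_of_tendsto_nhds_of_eventually_within
    · have : Continuous fun t : ℝ => 2 * t := by fun_prop
      simpa using (this.tendsto 0).mono_left nhdsWithin_le_nhds
    · filter_upwards [self_mem_nhdsWithin] with t (ht : 0 < t)
      show 0 < 2 * t
      linarith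
  have h1 := tendsto_slope_convexDirDeriv hf hcore (d + e)
  have h2 := ((tendsto_slope_convexDirDeriv hf hcore d).comp hmap).add
    ((tendsto_slope_convexDirDeriv hf hcore e).comp hmap)
  have hd' : ∀ᶠ s in 𝓝[>] (0 : ℝ), x + s • d ∈ D :=
    mem_nhdsWithin_of_mem_nhds (mem_interior_iff_mem_nhds.1 (zero_mem_interior_line hf.1 hcore d))
  have he' : ∀ᶠ s in 𝓝[>] (0 : ℝ), x + s • e ∈ D :=
    mem_nhdsWithin_of_mem_nhds (mem_interior_iff_mem_nhds.1 (zero_mem_interior_line hf.1 hcore e))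
  have hevd : ∀ᶠ t in 𝓝[>] (0 : ℝ), x + (2 * t) • d ∈ D := hmap.eventually hd'
  have heve : ∀ᶠ t in 𝓝[>] (0 : ℝ), x + (2 * t) • e ∈ D := hmap.eventually he'
  refine le_of_tendsto_of_tendsto h1 h2 ?_
  filter_upwards [hevd, heve, self_mem_nhdsWithin] with t hd he (ht : 0 < t)
  simp only [Function.comp_def]
  have hmid : x + t • (d + e) =
      (1 / 2 : ℝ) • (x + (2 * t) • d) + (1 / 2 : ℝ) • (x + (2 * t) • e) := by
    simp only [smul_add, smul_smul]
    module
  have hconv := hf.2 hd he (by norm_num : (0 : ℝ) ≤ 1 / 2) (by norm_num : (0 : ℝ) ≤ 1 / 2)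
    (by norm_num)
  rw [← hmid, smul_eq_mul, smul_eq_mul] at hconv
  rw [← add_div, div_le_div_iff₀ ht (by positivity)]
  nlinarith

/-- **Proposition 4.2.4** (Sublinearity of the Directional Derivative): at a core point of
`dom f` the directional derivative `f'(x̄; ·)` is everywhere finite and sublinear.
[cite: BorweinZhu2005, §4.2.2, Prop 4.2.4, p. 119] -/
theorem isSublinear_convexDirDeriv (hf : ConvexOn ℝ D f)
    (hcore : ∀ d : X, ∃ t : ℝ, 0 < t ∧ x + t • d ∈ D) : IsSublinear (convexDirDeriv f x) :=
  isSublinear_iff.2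
    ⟨fun d _ ha => convexDirDeriv_smul hf hcore ha d, fun d e => convexDirDeriv_add_le hf hcore d e⟩

/-- **Proposition 4.2.5** (Subgradients and Directional Derivatives), "only if": a subgradient
is dominated by the directional derivative, `⟨x*, h⟩ ≤ f'(x̄; h)`.
[cite: BorweinZhu2005, §4.2.2, Prop 4.2.5, p. 119] -/
theorem apply_le_convexDirDeriv (hf : ConvexOn ℝ D f)
    (hcore : ∀ d : X, ∃ t : ℝ, 0 < t ∧ x + t • d ∈ D) {xs : X →L[ℝ] ℝ}
    (hxs : xs ∈ convexSubdiff D f x) (h : X) : xs h ≤ convexDirDeriv f x h := by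
  have hlim := tendsto_slope_convexDirDeriv hf hcore h
  have hev : ∀ᶠ t in 𝓝[>] (0 : ℝ), x + t • h ∈ D :=
    mem_nhdsWithin_of_mem_nhds (mem_interior_iff_mem_nhds.1 (zero_mem_interior_line hf.1 hcore h))
  refine ge_of_tendsto hlim ?_
  filter_upwards [hev, self_mem_nhdsWithin] with t htD (ht : 0 < t)
  have := hxs (x + t • h) htD
  rw [add_sub_cancel_left, map_smul, smul_eq_mul] at this
  rw [le_div_iff₀ ht]
  linarith

/-- **Proposition 4.2.5** (Subgradients and Directional Derivatives): for `x̄ ∈ core(dom f)`,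
`x* ∈ ∂f(x̄)` if and only if `⟨x*, ·⟩ ≤ f'(x̄; ·)`.
[cite: BorweinZhu2005, §4.2.2, Prop 4.2.5, pp. 119–120] -/
theorem mem_convexSubdiff_iff_forall_le_convexDirDeriv (hf : ConvexOn ℝ D f)
    (hcore : ∀ d : X, ∃ t : ℝ, 0 < t ∧ x + t • d ∈ D) {xs : X →L[ℝ] ℝ} :
    xs ∈ convexSubdiff D f x ↔ ∀ h : X, xs h ≤ convexDirDeriv f x h := by
  refine ⟨fun hxs h => apply_le_convexDirDeriv hf hcore hxs h, fun H y hy => ?_⟩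
  have h1 := H (y - x)
  have h2 := convexDirDeriv_le_slope hf hcore (y - x) one_pos (by simpa using hy)
  rw [one_smul, add_sub_cancel, div_one] at h2
  exact h1.trans h2

/-- Step of the printed proof of Theorem 4.2.7: if `L` is a Lipschitz constant of `f` near
`x̄`, then `|f'(x̄; h)| ≤ L‖h‖` for all `h`.
[cite: BorweinZhu2005, §4.2.3, proof of Thm 4.2.7, pp. 120–121] -/
theorem abs_convexDirDeriv_le (hf : ConvexOn ℝ D f)
    (hcore : ∀ d : X, ∃ t : ℝ, 0 < t ∧ x + t • d ∈ D) {L : ℝ}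
    (hL : ∀ᶠ y in 𝓝 x, |f y - f x| ≤ L * ‖y - x‖) (h : X) :
    |convexDirDeriv f x h| ≤ L * ‖h‖ := by
  have hlim := (tendsto_slope_convexDirDeriv hf hcore h).abs
  have hc : Tendsto (fun t : ℝ => x + t • h) (𝓝 0) (𝓝 x) := by
    have : Continuous fun t : ℝ => x + t • h := by fun_prop
    simpa using this.tendsto 0
  have hev : ∀ᶠ t in 𝓝[>] (0 : ℝ), |f (x + t • h) - f x| ≤ L * ‖x + t • h - x‖ :=
    (hc.eventually hL).filter_mono nhdsWithin_le_nhds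
  refine le_of_tendsto hlim ?_
  filter_upwards [hev, self_mem_nhdsWithin] with t htL (ht : 0 < t)
  rw [add_sub_cancel_left, norm_smul, Real.norm_eq_abs, abs_of_pos ht] at htL
  rw [abs_div, abs_of_pos ht, div_le_iff₀ ht]
  linarith

/-- Under **Q2** (`x̄ ∈ cont f`): a convex function continuous at an interior point of its
domain is Lipschitz near that point (Proposition 4.1.2, here through Mathlib's
`ConvexOn.continuousOn_tfae`), giving the constant `L` of the printed proof of Theorem 4.2.7.
[cite: BorweinZhu2005, §4.2.3, proof of Thm 4.2.7, pp. 120–121; §4.1.2, Prop 4.1.2, p. 112] -/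
theorem exists_lipschitz_bound_of_continuousAt (hf : ConvexOn ℝ D f) (hD : D ∈ 𝓝 x)
    (hc : ContinuousAt f x) : ∃ L : ℝ, 0 ≤ L ∧ ∀ᶠ y in 𝓝 x, |f y - f x| ≤ L * ‖y - x‖ := by
  have hxi : x ∈ interior D := mem_interior_iff_mem_nhds.2 hD
  have hfi : ConvexOn ℝ (interior D) f := hf.subset interior_subset hf.1.interior
  have h3 : ∃ x₀ ∈ interior D, ContinuousAt f x₀ := ⟨x, hxi, hc⟩
  have hll : LocallyLipschitzOn (interior D) f :=
    ((hfi.continuousOn_tfae isOpen_interior ⟨x, hxi⟩).out 2 0).mp h3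
  obtain ⟨K, t, ht, hK⟩ := hll hxi
  rw [isOpen_interior.nhdsWithin_eq hxi] at ht
  refine ⟨K, K.2, ?_⟩
  filter_upwards [ht] with y hy
  have := hK.norm_sub_le hy (mem_of_mem_nhds ht)
  rwa [Real.norm_eq_abs] at this

end DirectionalDerivative

/-! ## §4.2.3 The max formula (Theorem 4.2.7), nonemptiness (Theorem 4.2.8), Corollary 4.2.9 -/

section MaxFormula

variable {D : Set X} {f : X → ℝ} {x : X}

/-- **Theorem 4.2.7** (Max Formula), attainment, under **Q2** (`x̄ ∈ cont f`): for every
direction `d` there is a subgradient `x* ∈ ∂f(x̄)` with `⟨x*, d⟩ = f'(x̄; d)`. The printed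
Zorn's-lemma construction is replaced by the dominated (Hahn–Banach) extension of
`t d ↦ t f'(x̄; d)` from `span {d}`, dominated by the sublinear `p = f'(x̄; ·)`; continuity of
the extension comes from `|p(h)| ≤ L‖h‖`.
[cite: BorweinZhu2005, §4.2.3, Thm 4.2.7, p. 120] -/
theorem exists_mem_convexSubdiff_apply_eq (hf : ConvexOn ℝ D f) (hD : D ∈ 𝓝 x)
    (hc : ContinuousAt f x) (d : X) :
    ∃ xs ∈ convexSubdiff D f x, xs d = convexDirDeriv f x d := by
  have hcore : ∀ e : X, ∃ t : ℝ, 0 < t ∧ x + t • e ∈ D := fun e => core_of_mem_nhds hD e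
  set p := convexDirDeriv f x with hp
  have hsub : IsSublinear p := isSublinear_convexDirDeriv hf hcore
  have hhom := hsub.isPosHomogeneous
  have hadd := hsub.isSubadditive
  obtain ⟨L, -, hL⟩ := exists_lipschitz_bound_of_continuousAt hf hD hc
  have hbound : ∀ h, |p h| ≤ L * ‖h‖ := fun h => abs_convexDirDeriv_le hf hcore hL h
  -- the linear functional `t • d ↦ t * p d` on `span {d}`
  have H : ∀ c : ℝ, c • d = 0 → (RingHom.id ℝ) c • p d = 0 := by
    intro c hc
    rcases smul_eq_zero.1 hc with h | h
    · simp [h]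
    · simp [h, hp, convexDirDeriv_zero]
  have hdom : ∀ z : (LinearPMap.mkSpanSingleton' d (p d) H).domain,
      (LinearPMap.mkSpanSingleton' d (p d) H) z ≤ p z := by
    rintro ⟨z, hz⟩
    obtain ⟨c, rfl⟩ := Submodule.mem_span_singleton.1 hz
    rw [LinearPMap.mkSpanSingleton'_apply]
    simp only [RingHom.id_apply, smul_eq_mul]
    show c * p d ≤ p (c • d)
    rcases le_or_gt 0 c with hc0 | hc0
    · rw [hhom d c hc0]
    · have hc' : 0 ≤ -c := by linarith
      have e : c • d = (-c) • (-d) := by rw [smul_neg, neg_smul, neg_neg]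
      rw [e, hhom (-d) (-c) hc']
      have := hsub.neg_le d
      nlinarith
  obtain ⟨g, hg_eq, hg_le⟩ :=
    exists_extension_of_le_sublinear _ p (fun c hc y => hhom y c hc.le) hadd hdom
  have hgb : ∀ h, |g h| ≤ L * ‖h‖ := by
    intro h
    rw [abs_le]
    constructor
    · have h1 := hg_le (-h)
      have h2 := (le_abs_self _).trans (hbound (-h))
      rw [norm_neg] at h2
      rw [map_neg] at h1
      linarith
    · exact (hg_le h).trans ((le_abs_self _).trans (hbound h))
  let xs : X →L[ℝ] ℝ := g.mkContinuous L fun h => by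
    simpa [Real.norm_eq_abs] using hgb h
  refine ⟨xs, ?_, ?_⟩
  · rw [mem_convexSubdiff_iff_forall_le_convexDirDeriv hf hcore]
    intro h
    simpa [xs] using hg_le h
  · have hdmem : d ∈ (LinearPMap.mkSpanSingleton' d (p d) H).domain := by
      rw [LinearPMap.domain_mkSpanSingleton]
      exact Submodule.mem_span_singleton_self d
    have h1 := hg_eq ⟨d, hdmem⟩
    have h2 : (LinearPMap.mkSpanSingleton' d (p d) H) ⟨d, hdmem⟩ = p d :=
      LinearPMap.mkSpanSingleton'_apply_self d (p d) H hdmem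
    rw [h2] at h1
    simpa [xs] using h1

/-- **Theorem 4.2.7** (Max Formula) under **Q2**:
`f'(x̄; d) = max {⟨x*, d⟩ | x* ∈ ∂f(x̄)}` (4.2.3).
[cite: BorweinZhu2005, §4.2.3, Thm 4.2.7, (4.2.3), p. 120] -/
theorem max_formula (hf : ConvexOn ℝ D f) (hD : D ∈ 𝓝 x) (hc : ContinuousAt f x) (d : X) :
    IsGreatest ((fun xs : X →L[ℝ] ℝ => xs d) '' convexSubdiff D f x)
      (convexDirDeriv f x d) := by
  obtain ⟨xs, hxs, heq⟩ := exists_mem_convexSubdiff_apply_eq hf hD hc d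
  refine ⟨⟨xs, hxs, heq⟩, ?_⟩
  rintro _ ⟨ys, hys, rfl⟩
  exact apply_le_convexDirDeriv hf (fun e => core_of_mem_nhds hD e) hys d

/-- **Theorem 4.2.8** (Nonemptiness of Subdifferential) under **Q2**: if `f` is convex and
continuous at the interior point `x̄` of `dom f`, then `∂f(x̄) ≠ ∅`.
[cite: BorweinZhu2005, §4.2.3, Thm 4.2.8, pp. 120–121] -/
theorem convexSubdiff_nonempty (hf : ConvexOn ℝ D f) (hD : D ∈ 𝓝 x)
    (hc : ContinuousAt f x) : (convexSubdiff D f x).Nonempty := by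
  obtain ⟨xs, hxs, -⟩ := exists_mem_convexSubdiff_apply_eq hf hD hc 0
  exact ⟨xs, hxs⟩

/-- **Theorem 4.2.8**, alternative reading (p. 121): there is a continuous linear functional
`x*` such that `f - x*` attains its minimum over `dom f` at `x̄`.
[cite: BorweinZhu2005, §4.2.3, Thm 4.2.8 and the remark following Cor 4.2.9, pp. 120–121] -/
theorem exists_isMinOn_sub (hf : ConvexOn ℝ D f) (hD : D ∈ 𝓝 x) (hc : ContinuousAt f x) :
    ∃ xs : X →L[ℝ] ℝ, IsMinOn (fun y => f y - xs y) D x := by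
  obtain ⟨xs, hxs⟩ := convexSubdiff_nonempty hf hD hc
  refine ⟨xs, isMinOn_iff.2 fun y hy => ?_⟩
  have := hxs y hy
  rw [map_sub] at this
  linarith

/-- `f` is **Gâteaux differentiable** at `x` with derivative `x* ∈ X*`: for every `v` the
directional derivative `f'(x; v)` exists and equals `⟨x*, v⟩`.
[cite: BorweinZhu2005, §4.2.3, p. 121] -/
def IsGateauxDerivAt (f : X → ℝ) (x : X) (xs : X →L[ℝ] ℝ) : Prop :=
  ∀ v : X, Tendsto (fun t : ℝ => (f (x + t • v) - f x) / t) (𝓝[>] 0) (𝓝 (xs v))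

/-- [cite: BorweinZhu2005, §4.2.3, Cor 4.2.9, p. 121] -/
theorem IsGateauxDerivAt.convexDirDeriv_eq (hf : ConvexOn ℝ D f)
    (hcore : ∀ d : X, ∃ t : ℝ, 0 < t ∧ x + t • d ∈ D) {xs : X →L[ℝ] ℝ}
    (h : IsGateauxDerivAt f x xs) (v : X) : convexDirDeriv f x v = xs v :=
  tendsto_nhds_unique (tendsto_slope_convexDirDeriv hf hcore v) (h v)

/-- **Corollary 4.2.9**, "only if" (valid at any core point): if `f` is Gâteaux differentiable
at `x̄` then the derivative is its unique subgradient there.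
[cite: BorweinZhu2005, §4.2.3, Cor 4.2.9, p. 121; §4.2.4, Exercise 4.2.15, p. 123] -/
theorem IsGateauxDerivAt.convexSubdiff_eq (hf : ConvexOn ℝ D f)
    (hcore : ∀ d : X, ∃ t : ℝ, 0 < t ∧ x + t • d ∈ D) {xs : X →L[ℝ] ℝ}
    (h : IsGateauxDerivAt f x xs) : convexSubdiff D f x = {xs} := by
  have hd := h.convexDirDeriv_eq hf hcore
  ext ys
  rw [mem_singleton_iff, mem_convexSubdiff_iff_forall_le_convexDirDeriv hf hcore]
  constructor
  · intro H
    ext v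
    have h1 := H v
    have h2 := H (-v)
    rw [hd] at h1 h2
    rw [map_neg, map_neg] at h2
    linarith
  · rintro rfl v
    rw [hd]

/-- **Corollary 4.2.9**, "if", under **Q2**: if `∂f(x̄) = {x*}` then `f` is Gâteaux
differentiable at `x̄` with derivative `x*` (by the max formula).
[cite: BorweinZhu2005, §4.2.3, Cor 4.2.9, p. 121; §4.2.4, Exercise 4.2.15, p. 123] -/
theorem isGateauxDerivAt_of_convexSubdiff_eq_singleton (hf : ConvexOn ℝ D f) (hD : D ∈ 𝓝 x)
    (hc : ContinuousAt f x) {xs : X →L[ℝ] ℝ} (h : convexSubdiff D f x = {xs}) :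
    IsGateauxDerivAt f x xs := by
  intro v
  obtain ⟨ys, hys, heq⟩ := exists_mem_convexSubdiff_apply_eq hf hD hc v
  rw [h, mem_singleton_iff] at hys
  subst hys
  rw [heq]
  exact tendsto_slope_convexDirDeriv hf (fun e => core_of_mem_nhds hD e) v

/-- **Corollary 4.2.9** (Differentiability of Convex Functions) under **Q2**: `f` is Gâteaux
differentiable at `x̄` exactly when `f` has a unique subgradient at `x̄` (in which case this
subgradient is the derivative).
[cite: BorweinZhu2005, §4.2.3, Cor 4.2.9, p. 121; §4.2.4, Exercise 4.2.15, p. 123] -/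
theorem exists_isGateauxDerivAt_iff_existsUnique (hf : ConvexOn ℝ D f) (hD : D ∈ 𝓝 x)
    (hc : ContinuousAt f x) :
    (∃ xs, IsGateauxDerivAt f x xs) ↔ ∃! xs, xs ∈ convexSubdiff D f x := by
  have hcore : ∀ e : X, ∃ t : ℝ, 0 < t ∧ x + t • e ∈ D := fun e => core_of_mem_nhds hD e
  constructor
  · rintro ⟨xs, hxs⟩
    refine ⟨xs, ?_, fun ys hys => ?_⟩
    · rw [hxs.convexSubdiff_eq hf hcore]; rfl
    · rw [hxs.convexSubdiff_eq hf hcore] at hys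
      exact hys
  · rintro ⟨xs, hxs, huniq⟩
    refine ⟨xs, isGateauxDerivAt_of_convexSubdiff_eq_singleton hf hD hc ?_⟩
    exact eq_singleton_iff_unique_mem.2 ⟨hxs, huniq⟩

end MaxFormula

/-! ## Examples: `-√x`, `|x|`, `ι_{ℝ₊}` (p. 120, Exercise 4.2.3) and the norm (Exercise 4.2.4) -/

section Examples

/-- The function `x ↦ -√x` (for `x ≥ 0`, `+∞` otherwise) of the example following
Corollary 4.2.9 is convex.
[cite: BorweinZhu2005, §4.2.3, p. 121; §4.2.4, Exercise 4.2.3 (iii), p. 122] -/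
theorem convexOn_neg_sqrt : ConvexOn ℝ (Ici (0 : ℝ)) (fun x : ℝ => -√x) :=
  Real.strictConcaveOn_sqrt.concaveOn.neg

/-- The example following Corollary 4.2.9 (= Exercise 4.2.3 (iii)): for `f(x) = -√x` (`x ≥ 0`),
`∂f(0) = ∅` — the point `0` is not in the core of `dom f = [0, ∞)`.
[cite: BorweinZhu2005, §4.2.3, p. 121; §4.2.4, Exercise 4.2.3 (iii), p. 122] -/
theorem convexSubdiff_neg_sqrt_zero :
    convexSubdiff (Ici (0 : ℝ)) (fun x : ℝ => -√x) 0 = ∅ := by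
  rw [eq_empty_iff_forall_notMem]
  intro xs hxs
  set c := xs 1 with hc
  have key : ∀ t : ℝ, 0 < t → t * c ≤ -1 := by
    intro t ht
    have h := hxs (t ^ 2) (by positivity : (0 : ℝ) ≤ t ^ 2)
    have e1 : xs (t ^ 2 - 0) = t ^ 2 * c := by
      have := xs.map_smul (t ^ 2) (1 : ℝ)
      rw [smul_eq_mul, mul_one, smul_eq_mul] at this
      rw [sub_zero, this]
    rw [e1] at h
    simp only [Real.sqrt_zero, neg_zero, sub_zero, Real.sqrt_sq ht.le] at h
    nlinarith
  have hpos : (0 : ℝ) < |c| + 1 := by positivity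
  have h1 := key (1 / (|c| + 1)) (by positivity)
  rw [one_div, inv_mul_le_iff₀ hpos] at h1
  linarith [neg_abs_le c]

/-- **Exercise 4.2.3 (i)**: for `f(x) = |x|` on `ℝ`, `x* ∈ ∂f(0)` iff `|x*(1)| ≤ 1`, i.e.
`∂|·|(0) = [-1, 1]`.
[cite: BorweinZhu2005, §4.2.4, Exercise 4.2.3 (i), p. 122] -/
theorem mem_convexSubdiff_abs_zero_iff (xs : ℝ →L[ℝ] ℝ) :
    xs ∈ convexSubdiff univ (fun x : ℝ => |x|) 0 ↔ |xs 1| ≤ 1 := by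
  have e : ∀ h : ℝ, xs h = h * xs 1 := by
    intro h
    have := xs.map_smul h (1 : ℝ)
    rw [smul_eq_mul, mul_one, smul_eq_mul] at this
    exact this
  simp only [mem_convexSubdiff_iff, mem_univ, true_imp_iff, sub_zero, abs_zero]
  constructor
  · intro H
    have h1 := H 1
    have h2 := H (-1)
    rw [e (-1)] at h2
    rw [abs_le]
    constructor <;> [linarith [abs_neg (1:ℝ), abs_one (α := ℝ)]; linarith [abs_one (α := ℝ)]]
  · intro H h
    rw [e h]
    have := abs_mul h (xs 1)
    nlinarith [le_abs_self (h * xs 1), abs_nonneg h]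

/-- **Exercise 4.2.3 (ii)**: for the indicator function `ι_{ℝ₊}`, `x* ∈ ∂ι_{ℝ₊}(0) = N(ℝ₊; 0)`
iff `x*(1) ≤ 0`, i.e. `∂ι_{ℝ₊}(0) = (-∞, 0]`.
[cite: BorweinZhu2005, §4.2.4, Exercise 4.2.3 (ii), p. 122] -/
theorem mem_convexNormalCone_Ici_zero_iff (xs : ℝ →L[ℝ] ℝ) :
    xs ∈ convexNormalCone (Ici (0 : ℝ)) 0 ↔ xs 1 ≤ 0 := by
  have e : ∀ h : ℝ, xs h = h * xs 1 := by
    intro h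
    have := xs.map_smul h (1 : ℝ)
    rw [smul_eq_mul, mul_one, smul_eq_mul] at this
    exact this
  rw [mem_convexNormalCone_iff]
  constructor
  · intro H
    simpa using H 1 (by simp)
  · intro H y hy
    rw [sub_zero, e y]
    exact mul_nonpos_of_nonneg_of_nonpos hy H

variable {x : X} {xs : X →L[ℝ] ℝ}

/-- **Exercise 4.2.4** (Subgradients of Norm): `x* ∈ ∂‖·‖(x)` iff `x* ≤ ‖·‖` (i.e. `‖x*‖ ≤ 1`)
and `⟨x*, x⟩ = ‖x‖`.
[cite: BorweinZhu2005, §4.2.4, Exercise 4.2.4, p. 123] -/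
theorem mem_convexSubdiff_norm_iff :
    xs ∈ convexSubdiff univ (fun y : X => ‖y‖) x ↔ (∀ h : X, xs h ≤ ‖h‖) ∧ xs x = ‖x‖ := by
  simp only [mem_convexSubdiff_iff, mem_univ, true_imp_iff]
  constructor
  · intro H
    have h0 := H 0
    rw [zero_sub, map_neg, norm_zero, zero_sub] at h0
    have h2 := H ((2 : ℝ) • x)
    rw [show (2 : ℝ) • x - x = x by rw [two_smul, add_sub_cancel_right], norm_smul,
      Real.norm_eq_abs, abs_two] at h2
    have hx : xs x = ‖x‖ := by linarith
    refine ⟨fun h => ?_, hx⟩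
    have := H (x + h)
    rw [add_sub_cancel_left] at this
    linarith [norm_add_le x h]
  · rintro ⟨H, hx⟩ y
    rw [map_sub, hx]
    linarith [H y]

/-- **Exercise 4.2.4** at the origin: `∂‖·‖(0) = {x* | x* ≤ ‖·‖}`.
[cite: BorweinZhu2005, §4.2.4, Exercise 4.2.4, p. 123] -/
theorem mem_convexSubdiff_norm_zero_iff :
    xs ∈ convexSubdiff univ (fun y : X => ‖y‖) 0 ↔ ∀ h : X, xs h ≤ ‖h‖ := by
  rw [mem_convexSubdiff_norm_iff]
  simp

/-- **Exercise 4.2.4** at the origin, dual-ball form: `∂‖·‖(0)` is the closed unit ball of `X*`.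
[cite: BorweinZhu2005, §4.2.4, Exercise 4.2.4, p. 123] -/
theorem mem_convexSubdiff_norm_zero_iff_norm_le :
    xs ∈ convexSubdiff univ (fun y : X => ‖y‖) 0 ↔ ‖xs‖ ≤ 1 := by
  rw [mem_convexSubdiff_norm_zero_iff]
  constructor
  · intro H
    refine ContinuousLinearMap.opNorm_le_bound xs zero_le_one fun h => ?_
    rw [one_mul, Real.norm_eq_abs, abs_le]
    refine ⟨?_, H h⟩
    have := H (-h)
    rw [map_neg, norm_neg] at this
    linarith
  · intro H h
    calc xs h ≤ ‖xs h‖ := Real.le_norm_self _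
      _ ≤ ‖xs‖ * ‖h‖ := xs.le_opNorm h
      _ ≤ 1 * ‖h‖ := by gcongr
      _ = ‖h‖ := one_mul _

end Examples

end Literature.Analysis.Convex.ConvexSubdifferentialMaxFormula
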